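import Literature.MathematicalPhysics.QuantumFieldTheory.Balaban1983to89.B13PrimitiveKernels216
import Literature.MathematicalPhysics.QuantumFieldTheory.Balaban1983to89.B13Lemma3TorusPrimitivePoly

/-!
# `Balaban1983to89.B13PrimitiveKernels216Holo` — T. Bałaban, *Renormalization group approach to lattice gauge field theories. II.
Cluster expansions*, Commun. Math. Phys. **116** (1988) 1–22 [Balaban1988RG2Cluster], pp. 15–17: (2.26) for one term of the two-scale
TORUS model from the two named (2.16)-level records `Localisation17a ∧ Differences216` (resp. from L17a and TWO difference bounds)
WITHOUT the two regularity hypotheses `hΨσ`, `hΨτ` (separate holomorphy of the (2.14) `X`-integral in `σ(Z)` and in `τ`) — the twins of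
`B13PrimitiveKernels216.h226_torus_of_kernelBounds` and `B13PrimitiveKernels216Reduced.h226_torus_of_two` over the cell-gaps joiner
`B13Lemma3TorusPrimitivePoly.h226_torus_of_primitives_holo_polyτ`, which DERIVES both slots from entrywise σ-holomorphy of the primitive
kernels, measurability of the last line's ingredients, and the (2.15)–(2.23) letters on an OPEN σ-polydisc (print p. 15's bigger
analyticity space)

statement-level skeleton of published theorems with citation tags; kernel-checked compositions of tree theorems; nothing here is a
claim about the Yang–Mills mass gap.

WHY (cell `pub-ymgap`, D-0062 Track A, node N10 = [Balaban1988RG2Cluster] Lemmas 1–3; seat `dag-n10-c` g2, module 11).  After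
modules 1–10 of this seat the displayed hypotheses of N10's Lemma-3 side that are NOT NODE A's kernel data are: complex symmetry `hAs`,
`hlin` (definitional), the dictionary `hT₃`, and the two regularity hypotheses `hΨσ ∕ hΨτ : SepHolOn U (… core214 …)` — print p. 15
*"We consider it as an analytic function … of the complex parameters σ(Z), τ"*, classed «LOCATED-ROUTINE given the objects» in
`B13Lemma3TorusSocket`.  The N10 torus chain (`B13Lemma3TorusPrimitive.h226_torus_of_primitives` → `B13PrimitiveKernels216.
h226_torus_of_kernelBounds` → `…Reduced.h226_torus_of_two` → `B13Lemma3TorusBinders.h226_torus_of_primitives_of_lemma2` →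
`B13NodeTorusKernel216.{h226_torus_of_kernel216_of_lemma2, termwise226_of_kernel216, b13Leaf_twoTorus_kernel216}` → this seat's walks
leaves) passes `hΨσ ∕ hΨτ` through unchanged at every storey, although the cell `pub-balaban-gaps` (seat ne5) landed their DERIVATION from
primitive data (`B13Core214Holomorphic` ∕ `…Primitive` ∕ `B13Bound226LocatedPoly` ∕ the torus joiner `B13Lemma3TorusPrimitivePoly`,
consumed today only by the NE5 row's Summit-side files and by N18).  THIS FILE re-issues the next two storeys of the N10 chain WITHOUT
`hΨσ ∕ hΨτ`, BY NAME over that joiner.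

THE HONEST TRADE (both theorems).  REMOVED: `hΨσ`, `hΨτ`.  ADDED: entrywise holomorphy of `A(σ)` and `G(σ)` on the open σ-polydisc
(`hAhol`, `hGhol`), measurability of `χ_{k,Y₀}`, `χᶜ_{k,P}`, `𝐕_k(Y,·)` (`hχm hχcm hVm`).  CHANGED: (i) the σ-letters are asked on an
OPEN σ-polydisc containing the closed `e^{κ₁}`-ball — in §1 an arbitrary open `Uσ` with the two records taken at a constants record `cp`
whose CLOSED `e^{κ₁}`-polydisc contains `Uσ` (`closedBall (e^{c.κ₁}) ⊆ Uσ ⊆ closedBall (e^{cp.κ₁})`; `cp` only lends its `κ₁`), in §2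
concretely `Uσ :=` the open `e^{cp.κ₁}`-ball, `c.κ₁ < cp.κ₁`, with `hAs hA hlin`, L17a and the two difference bounds on the closed
`e^{cp.κ₁}`-polydisc (the same glue as ne5's `Spine/NE5/TwoRunTorusWalkH226.sigma_region_glue` with `cp = {c with κ₁ := c.κ₁ + 1}`);
(ii) the τ-domain is PER-DOMAIN, `Uτ : 𝐃-index → Set ℂ` with `Uτ Y ⊇ {|z| ≤ |τ(Y)| = (invTau c (d_k Y))⁻¹}` (print's radii (2.18)), and
(2.20) is asked on the open region `Π_Y Uτ Y` (`h220U`) instead of at the radii (`h220R` is its value at the point `τ = (|τ(Y)|)_Y`,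
derived inside) — the torus-uniform form of the cell record (x8).  Same conclusion `‖(2.14)‖ ≤ weight L M c Z a t · e^{a₅|Z|}`, same
constants.
* §1 `h226_torus_of_kernelBounds_holo` — twin of `B13PrimitiveKernels216.h226_torus_of_kernelBounds`.
* §2 `h226_torus_of_two_holo` — twin of `B13PrimitiveKernels216Reduced.h226_torus_of_two` (`θ_C` derived by `differences216_of_two` at `cp`,
  L17a dropped from `κ₁` to `κ` by `localisation17a_mono_rate`).
LOCATED, FOR THE NEXT STOREY (not done here; recorded so that it is not re-discovered).  `B13Lemma3TorusBinders.h226_torus_of_primitives_of_lemma2`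
DERIVES (2.20) at the radii (`h220R`) from Lemma 2's (1.42)∕(1.43) of the step of record with the matched letter
`a₂₀ = m′·α₄·M⁻⁴(1 + 32∕(κ₁−1))⁴`.  Its `hΨτ`-free twin needs (2.20) on an OPEN per-domain region `Uτ Y ⊋ {|z| ≤ |τ(Y)|}`, where
`sup |τ(Y)|` exceeds the radius: either the region is taken with radii `(1+ε)|τ(Y)|` and the letters `(a₂₀, w)` inflate by `(1+ε)` — to be
threaded through `B13Lemma3TorusSocket.Lemma3Numerics` and the leaves' `hαc ∕ hsmall ∕ hvol` —, or the Cauchy contour is shrunk to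
`|τ(Y)|∕(1+ε)` and the weight (2.18) pays `(1+ε)^{|𝐃|}`; print absorbs either in its `O(1)`'s.  That design choice belongs to the planner ∕
the successor of this seat; above it, `termwise226_of_kernel216`, `b13Leaf_twoTorus_kernel216` and the walks leaves re-key by `exact` with
NODE A's kernel data (`TermWalks`∕`TermWalksRef`, `hAs`, `hlin`) moved to the bigger polydisc and `hAhol ∕ hGhol ∕ hχm ∕ hχcm ∕ hVm` added.

CITATIONS.  [Balaban1988RG2Cluster] (2.14)–(2.15) p. 15, (2.16)–(2.22) p. 16, (2.23)–(2.26) p. 17; p. 15 (analyticity in σ(Z), τ; the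
bigger analyticity space with constants α′₀, α′₁).  [Balaban1985BackgroundPropagators] (3.108) p. 416 (shape of the localisation letters).

HONEST FRAMING: generic finite-dimensional complex analysis over the block model joined to the torus geometry BY NAME; every kernel
family and letter is a HYPOTHESIS; nothing of Bałaban's `Γ_k(Z₀,σ)`, `C^{(k)}(Z₀,σ)` is constructed or asserted; count-neutral Track-A side
landing; N10 NOT discharged; (D4) unchanged; one finite T⁴ programme at fixed ε; nothing continuum ∕ ℝ⁴ ∕ OS ∕ mass-gap ∕ Clay.
0 `sorry`, 0 `def`, no instance, no notation, standard axioms.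
-/

namespace Literature.MathematicalPhysics.QuantumFieldTheory.Balaban1983to89.B13PrimitiveKernels216Holo

open Metric Set Matrix
open Literature.MathematicalPhysics.QuantumFieldTheory.Balaban1983to89
open Literature.MathematicalPhysics.QuantumFieldTheory.Balaban1983to89.TreeLengthTorus (TPt TDom tsys)
open Literature.MathematicalPhysics.QuantumFieldTheory.Balaban1983to89.TreeLengthTorusTransfer (tclosure)
open Literature.MathematicalPhysics.QuantumFieldTheory.Balaban1983to89.B13Lemma3TorusData (TBond)
open Literature.MathematicalPhysics.QuantumFieldTheory.Balaban1983to89.B13Lemma3TorusTerms (weight Z0)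
open Literature.MathematicalPhysics.QuantumFieldTheory.Balaban1983to89.B13Term214 (term214 SepHolOn core214 F214)
open Literature.MathematicalPhysics.QuantumFieldTheory.Balaban1983to89.B13Bound143 (invTau)
open Literature.MathematicalPhysics.QuantumFieldTheory.Balaban1983to89.B5TorusCover (UT)
open Literature.MathematicalPhysics.QuantumFieldTheory.Balaban1983to89.B9Thm37GlueTorus (tdist1)
open Literature.MathematicalPhysics.QuantumFieldTheory.Balaban1983to89.B13Lemma3TorusPrimitivePoly
  (h226_torus_of_primitives_holo_polyτ)
open Literature.MathematicalPhysics.QuantumFieldTheory.Balaban1983to89.B13PrimitiveKernels216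
  (Localisation17a Differences216 localisation17a_mono_rate differences216_of_two)

noncomputable section

/-! ## §1. (2.26) for one term from the two named records on a bigger polydisc, `hΨσ ∕ hΨτ` derived -/

section KernelBounds

variable {d L N' : ℕ} [NeZero L] [NeZero N'] {M : ℕ}
variable {ν : ℕ} {Nf : Fin ν → ℕ} [∀ i, NeZero (Nf i)]
variable {Λ : Type} [Fintype Λ] [DecidableEq Λ] {C₀ : Type} [Fintype C₀] [DecidableEq C₀]

open Classical in
/-- **(2.26) FOR ONE TERM of the torus model from `Localisation17a ∧ Differences216` on a bigger polydisc, WITHOUT `hΨσ ∕ hΨτ`.**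
Exactly `B13PrimitiveKernels216.h226_torus_of_kernelBounds` (same conclusion `‖(2.14)‖ ≤ weight L M c Z a t · exp(a₅·|Z|)`, same
constants, binders in the same order) except: `hΨσ`, `hΨτ` REMOVED; ADDED: entrywise holomorphy of `A(σ)`, `G(σ)` on the open σ-polydisc
`{σ | ∀ j, σ j ∈ Uσ}` (`hAhol`, `hGhol`), measurability of `χ_{k,Y₀}`, `χᶜ_{k,P}`, `𝐕_k(Y,·)` (`hχm hχcm hVm`); CHANGED: `hAs hA hlin` are
asked on that open polydisc; the two records are taken at a constants record `cp` (only its `κ₁` is read) whose CLOSED `e^{κ₁}`-polydisc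
contains `Uσ` (`hUsub`; print p. 15's bigger analyticity space, `closedBall (e^{c.κ₁}) ⊆ Uσ ⊆ closedBall (e^{cp.κ₁})`); the τ-domain is
per-domain (`Uτ Y ⊇ {|z| ≤ |τ(Y)|}`) with (2.20) on the open region `Π_Y Uτ Y` (`h220U`) instead of at the radii.  Proof: the record
projections restricted to `Uσ`, then `B13Lemma3TorusPrimitivePoly.h226_torus_of_primitives_holo_polyτ`.
[cite: Balaban1988RG2Cluster, (2.14)–(2.16) pp.15–16, (2.26) p.17] -/
theorem h226_torus_of_kernelBounds_holo (c : B13.Consts) (hκ₁ : 1 ≤ c.κ₁) (hα₆ : c.α₆ ≠ 0)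
    (Z : TDom d N') (t : Finset (TDom d (L * N')) × Finset (TBond d M (L * N')))
    (hpos : ∀ Y : TDom d (L * N'), 0 < invTau c ((tsys d (L * N')).dj Y))
    (hhalf : ∀ Y : TDom d (L * N'), invTau c ((tsys d (L * N')).dj Y) ≤ 1 / 2)
    {Uσ : Set ℂ} {Uτ : TDom d (L * N') → Set ℂ} (hUσ : IsOpen Uσ) (hUτ : ∀ Y, IsOpen (Uτ Y))
    (hUexp : closedBall (0 : ℂ) (Real.exp c.κ₁) ⊆ Uσ)
    (hUtau : ∀ Y : TDom d (L * N'), closedBall (0 : ℂ) ((invTau c ((tsys d (L * N')).dj Y))⁻¹) ⊆ Uτ Y)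
    {r : ℝ} (hr : 0 < r) (hr' : r ≤ Real.exp c.κ₁ - 1)
    (hsubτ : ∀ Y, ∀ s ∈ Set.uIcc (0 : ℝ) 1, closedBall (s : ℂ) r ⊆ Uτ Y)
    -- the parameter lists of the term: σ over the blocks of Z∖Z′₀, τ over 𝐃
    (lZ : List (TPt d N')) (hlZ : lZ.Nodup ∧ lZ.toFinset = Z.1 \ tclosure L N' (Z0 M t))
    (lD : List (TDom d (L * N'))) (hlD : lD.Nodup ∧ lD.toFinset = t.1)
    -- the (2.14)-data of the term
    (A : (TPt d N' → ℂ) → Matrix Λ Λ ℂ) (Γ : (TPt d N' → ℂ) → (Λ ⊕ C₀ → ℝ) → (Λ → ℂ))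
    (χY₀ χcP : (Λ → ℝ) → ℝ) (hχ0 : ∀ B, 0 ≤ χY₀ B) (hχc0 : ∀ B, 0 ≤ χcP B) (Dfam : Finset (TDom d (L * N')))
    (V : TDom d (L * N') → (Λ → ℝ) → ℂ)
    {C : Matrix Λ Λ ℝ} (hC : C.PosDef) (Γ₀ : Matrix Λ (Λ ⊕ C₀) ℝ)
    -- REPLACES hΨσ ∕ hΨτ: entrywise holomorphy of `A(σ)` on the OPEN σ-polydisc, measurability of the last line's ingredients
    (hAhol : ∀ i j, DifferentiableOn ℂ (fun σ => A σ i j) {σ | ∀ j, σ j ∈ Uσ})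
    (hχm : Measurable χY₀) (hχcm : Measurable χcP) (hVm : ∀ Y, Measurable (V Y))
    (hAs : ∀ σ : TPt d N' → ℂ, (∀ j, σ j ∈ Uσ) → (A σ).IsSymm)
    (hA : ∀ σ : TPt d N' → ℂ, (∀ j, σ j ∈ Uσ) → ((A σ).map Complex.re).PosDef)
    -- the Γ-operator is linear with an entrywise holomorphic kernel G(σ)
    (G : (TPt d N' → ℂ) → Matrix Λ (Λ ⊕ C₀) ℂ)
    (hGhol : ∀ i j, DifferentiableOn ℂ (fun σ => G σ i j) {σ | ∀ j, σ j ∈ Uσ})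
    (hlin : ∀ σ : TPt d N' → ℂ, (∀ j, σ j ∈ Uσ) → ∀ X : Λ ⊕ C₀ → ℝ, Γ σ X = G σ *ᵥ fun j => (X j : ℂ))
    -- the (2.22) shape, and (2.20) on the open per-domain τ-region
    {γ₂ rP a₂₀ w : ℝ} (qP : (Λ → ℝ) → ℝ)
    (h222 : ∀ B, χY₀ B * χcP B ≤ Real.exp (-(γ₂ / 2 * rP ^ 2 * (t.2.card : ℕ)) + γ₂ / 2 * qP B)) (hγ₂ : 0 ≤ γ₂)
    (hqP : ∀ B, qP B ≤ B ⬝ᵥ B) (ha0 : 0 ≤ a₂₀)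
    (h220U : ∀ τ : TDom d (L * N') → ℂ, (∀ Y, τ Y ∈ Uτ Y) →
      ∀ B, ∑ Y ∈ Dfam, ‖τ Y‖ * ‖V Y B‖ ≤ a₂₀ / 2 * (B ⬝ᵥ B) + w)
    -- bonds located on the torus `UT Nf`
    (locΛ : Λ → UT Nf) (locN : Λ ⊕ C₀ → UT Nf) {m : ℕ}
    (hfibΛ : ∀ x : UT Nf, (Finset.univ.filter fun i => locΛ i = x).card ≤ m)
    (hfibN : ∀ x : UT Nf, (Finset.univ.filter fun j => locN j = x).card ≤ m)
    -- rates and constants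
    {kap kap' kap'' θ θE θΓ θC KG KΓ KCs K₀ : ℝ} (hkap'' : 0 < kap'') (h1 : kap'' < kap') (h2 : kap' < kap)
    (hθE : 0 ≤ θE) (hθΓ : 0 ≤ θΓ) (hθC : 0 ≤ θC) (hKG : 0 ≤ KG) (hKΓ : 0 ≤ KΓ) (hKCs : 0 ≤ KCs) (hK₀ : 0 ≤ K₀)
    (hθEle : θE ≤ θ) (hθΓle : θΓ ≤ θ)
    (hθR1le : (m * (1 + 2 / (kap - kap')) ^ ν) * (m * (1 + 2 / (kap' - kap'')) ^ ν)
      * (θΓ * KCs * KG + KΓ * θC * KG + KΓ * K₀ * θΓ) ≤ θ)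
    -- THE TWO NAMED HYPOTHESES (L17a, L16a) at a constants record `cp` whose closed `e^{κ₁}`-polydisc contains `Uσ`
    (cp : B13.Consts) (hUsub : Uσ ⊆ closedBall (0 : ℂ) (Real.exp cp.κ₁))
    (h17 : Localisation17a cp A G Γ₀ C locΛ locN kap KG KΓ KCs K₀)
    (h16 : Differences216 cp A G Γ₀ C locΛ locN kap θΓ θC θE)
    (hsmallKθ : K₀ * (m * (1 + 2 / kap) ^ ν) * (θ * (m * (1 + 2 / kap'') ^ ν)) < 1)
    -- the (2.24)–(2.25) smallness
    {cE g : ℝ} (hc0 : 0 ≤ cE) (hc : ∀ k, hC.1.eigenvalues k ≤ cE)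
    (hαc : (2 * (θ * (m * (1 + 2 / kap'') ^ ν)) + (γ₂ + a₂₀)) * cE ≤ 1 / 2) (hg : 0 ≤ g)
    (hΓq : ∀ X : Λ ⊕ C₀ → ℝ, (Γ₀ *ᵥ X) ⬝ᵥ (C *ᵥ (Γ₀ *ᵥ X)) ≤ g * (X ⬝ᵥ X))
    (hsmall : (2 * (θ * (m * (1 + 2 / kap'') ^ ν)) + (γ₂ + a₂₀)) * (1 + 2 * cE * g) ≤ 1 / 2)
    -- constant matching, p. 17: the |P|-rate of the weight and «exp O(1)α₅|Z|»
    {a a₅ : ℝ} (hPa : a ≤ γ₂ * rP ^ 2)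
    (hvol : 2 * (K₀ * (m * (1 + 2 / kap) ^ ν) * (θ * (m * (1 + 2 / kap'') ^ ν))
              * (1 + (1 - K₀ * (m * (1 + 2 / kap) ^ ν) * (θ * (m * (1 + 2 / kap'') ^ ν)))⁻¹) / 2)
          * (Fintype.card Λ : ℝ)
        + w + (2 * (θ * (m * (1 + 2 / kap'') ^ ν)) + (γ₂ + a₂₀)) * cE * (Fintype.card Λ : ℝ)
        + (2 * (θ * (m * (1 + 2 / kap'') ^ ν)) + (γ₂ + a₂₀)) * (1 + 2 * cE * g) * (Fintype.card (Λ ⊕ C₀) : ℝ)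
        ≤ a₅ * ((Z.1).card : ℝ)) :
    ‖term214 r lZ lD (core214 A Γ (F214 t.2.card χY₀ χcP Dfam V)) 0 0‖ ≤
      weight L M c Z a t * Real.exp (a₅ * ((Z.1).card : ℝ)) := by
  have hin : ∀ σ : TPt d N' → ℂ, (∀ j, σ j ∈ Uσ) → ∀ j, ‖σ j‖ ≤ Real.exp cp.κ₁ :=
    fun σ hσ j => mem_closedBall_zero_iff.1 (hUsub (hσ j))
  exact h226_torus_of_primitives_holo_polyτ c hκ₁ hα₆ Z t hpos hhalf hUσ hUτ hUexp hUtau hr hr' hsubτ lZ hlZ lD hlD A Γ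
    χY₀ χcP hχ0 hχc0 Dfam V hC Γ₀ hAhol hχm hχcm hVm hAs hA G hGhol hlin qP h222 hγ₂ hqP ha0 h220U locΛ locN hfibΛ
    hfibN hkap'' h1 h2 hθE hθΓ hθC hKG hKΓ hKCs hK₀ hθEle hθΓle hθR1le (fun σ hσ => h17.hG σ (hin σ hσ)) h17.hΓ₀
    (fun σ hσ => h17.hCs σ (hin σ hσ)) h17.hC216 (fun σ hσ => h16.hdΓ σ (hin σ hσ)) (fun σ hσ => h16.hdC σ (hin σ hσ))
    (fun σ hσ => h16.hdE σ (hin σ hσ)) hsmallKθ hc0 hc hαc hg hΓq hsmall hPa hvol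

end KernelBounds

/-! ## §2. (2.26) for one term from L17a and TWO σ-difference bounds on the bigger polydisc, `hΨσ ∕ hΨτ` derived -/

section Two

variable {d L N' : ℕ} [NeZero L] [NeZero N'] {M : ℕ}
variable {ν : ℕ} {Nf : Fin ν → ℕ} [∀ i, NeZero (Nf i)]
variable {Λ : Type} [Fintype Λ] [DecidableEq Λ] {C₀ : Type} [Fintype C₀] [DecidableEq C₀]

open Classical in
/-- **(2.26) FOR ONE TERM of the torus model from L17a and TWO σ-difference bounds on the BIGGER polydisc, WITHOUT `hΨσ ∕ hΨτ`.**
Exactly `B13PrimitiveKernels216Reduced.h226_torus_of_two` (same conclusion, same constants — in particular the derived covariance letter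
`θ_C = K_Cs·θ_E·(m(1+2∕(κ₁−κ₂))^ν)·K₀·(m(1+2∕(κ₂−κ))^ν)` inside `hθR1le` —, binders in the same order) except: `hΨσ`, `hΨτ` REMOVED; the
open σ-set `Uσ` with `hUσ`, `hUexp` REPLACED by a second constants record `c⁺` with `hκ⁺ : c.κ₁ < c⁺.κ₁` (only its `κ₁` is read: the open
σ-polydisc is the `e^{κ₁⁺}`-ball, which contains the closed `e^{κ₁}`-ball); ADDED: entrywise holomorphy of `A(σ)`, `G(σ)` on the open
`e^{κ₁⁺}`-polydisc (`hAhol`, `hGhol`), measurability `hχm hχcm hVm`; CHANGED: `hAs hA hlin`, the record `h17 : Localisation17a c⁺ …` and the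
difference bounds `hdΓ hdE` are asked on the CLOSED `e^{κ₁⁺}`-polydisc (the bigger analyticity domain of p. 15), the τ-domain is per-domain
(`Uτ Y`) with (2.20) on `Π_Y Uτ Y` (`h220U`).  Proof: `localisation17a_mono_rate` + `differences216_of_two` at `c⁺`, then
`B13Lemma3TorusPrimitivePoly.h226_torus_of_primitives_holo_polyτ` with `Uσ := ball 0 (e^{κ₁⁺})`. [cite: Balaban1988RG2Cluster, (2.14)–(2.16) pp.15–16, (2.26) p.17] -/
theorem h226_torus_of_two_holo (c : B13.Consts) (hκ₁ : 1 ≤ c.κ₁) (hα₆ : c.α₆ ≠ 0)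
    (Z : TDom d N') (t : Finset (TDom d (L * N')) × Finset (TBond d M (L * N')))
    (hpos : ∀ Y : TDom d (L * N'), 0 < invTau c ((tsys d (L * N')).dj Y))
    (hhalf : ∀ Y : TDom d (L * N'), invTau c ((tsys d (L * N')).dj Y) ≤ 1 / 2)
    (cp : B13.Consts) (hκp : c.κ₁ < cp.κ₁)
    {Uτ : TDom d (L * N') → Set ℂ} (hUτ : ∀ Y, IsOpen (Uτ Y))
    (hUtau : ∀ Y : TDom d (L * N'), closedBall (0 : ℂ) ((invTau c ((tsys d (L * N')).dj Y))⁻¹) ⊆ Uτ Y)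
    {r : ℝ} (hr : 0 < r) (hr' : r ≤ Real.exp c.κ₁ - 1)
    (hsubτ : ∀ Y, ∀ s ∈ Set.uIcc (0 : ℝ) 1, closedBall (s : ℂ) r ⊆ Uτ Y)
    (lZ : List (TPt d N')) (hlZ : lZ.Nodup ∧ lZ.toFinset = Z.1 \ tclosure L N' (Z0 M t))
    (lD : List (TDom d (L * N'))) (hlD : lD.Nodup ∧ lD.toFinset = t.1)
    (A : (TPt d N' → ℂ) → Matrix Λ Λ ℂ) (Γ : (TPt d N' → ℂ) → (Λ ⊕ C₀ → ℝ) → (Λ → ℂ))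
    (χY₀ χcP : (Λ → ℝ) → ℝ) (hχ0 : ∀ B, 0 ≤ χY₀ B) (hχc0 : ∀ B, 0 ≤ χcP B) (Dfam : Finset (TDom d (L * N')))
    (V : TDom d (L * N') → (Λ → ℝ) → ℂ)
    {C : Matrix Λ Λ ℝ} (hC : C.PosDef) (Γ₀ : Matrix Λ (Λ ⊕ C₀) ℝ)
    -- REPLACES hΨσ ∕ hΨτ
    (hAhol : ∀ i j, DifferentiableOn ℂ (fun σ => A σ i j)
      {σ : TPt d N' → ℂ | ∀ j, σ j ∈ ball (0 : ℂ) (Real.exp cp.κ₁)})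
    (hχm : Measurable χY₀) (hχcm : Measurable χcP) (hVm : ∀ Y, Measurable (V Y))
    (hAs : ∀ σ : TPt d N' → ℂ, (∀ j, ‖σ j‖ ≤ Real.exp cp.κ₁) → (A σ).IsSymm)
    (hA : ∀ σ : TPt d N' → ℂ, (∀ j, ‖σ j‖ ≤ Real.exp cp.κ₁) → ((A σ).map Complex.re).PosDef)
    (G : (TPt d N' → ℂ) → Matrix Λ (Λ ⊕ C₀) ℂ)
    (hGhol : ∀ i j, DifferentiableOn ℂ (fun σ => G σ i j)
      {σ : TPt d N' → ℂ | ∀ j, σ j ∈ ball (0 : ℂ) (Real.exp cp.κ₁)})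
    (hlin : ∀ σ : TPt d N' → ℂ, (∀ j, ‖σ j‖ ≤ Real.exp cp.κ₁) →
      ∀ X : Λ ⊕ C₀ → ℝ, Γ σ X = G σ *ᵥ fun j => (X j : ℂ))
    {γ₂ rP a₂₀ w : ℝ} (qP : (Λ → ℝ) → ℝ)
    (h222 : ∀ B, χY₀ B * χcP B ≤ Real.exp (-(γ₂ / 2 * rP ^ 2 * (t.2.card : ℕ)) + γ₂ / 2 * qP B)) (hγ₂ : 0 ≤ γ₂)
    (hqP : ∀ B, qP B ≤ B ⬝ᵥ B)
    (h220U : ∀ τ : TDom d (L * N') → ℂ, (∀ Y, τ Y ∈ Uτ Y) →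
      ∀ B, ∑ Y ∈ Dfam, ‖τ Y‖ * ‖V Y B‖ ≤ a₂₀ / 2 * (B ⬝ᵥ B) + w)
    (ha0 : 0 ≤ a₂₀)
    (locΛ : Λ → UT Nf) (locN : Λ ⊕ C₀ → UT Nf) {m : ℕ}
    (hfibΛ : ∀ x : UT Nf, (Finset.univ.filter fun i => locΛ i = x).card ≤ m)
    (hfibN : ∀ x : UT Nf, (Finset.univ.filter fun j => locN j = x).card ≤ m)
    {kap kap' kap'' kap₁ kap₂ θ θE θΓ KG KΓ KCs K₀ : ℝ} (hkap'' : 0 < kap'') (h1 : kap'' < kap') (h2 : kap' < kap)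
    (h3 : kap < kap₂) (h4 : kap₂ < kap₁)
    (hθE : 0 ≤ θE) (hθΓ : 0 ≤ θΓ) (hKG : 0 ≤ KG) (hKΓ : 0 ≤ KΓ) (hKCs : 0 ≤ KCs) (hK₀ : 0 ≤ K₀)
    (hθEle : θE ≤ θ) (hθΓle : θΓ ≤ θ)
    (hθR1le : (m * (1 + 2 / (kap - kap')) ^ ν) * (m * (1 + 2 / (kap' - kap'')) ^ ν)
      * (θΓ * KCs * KG
        + KΓ * (KCs * θE * (m * (1 + 2 / (kap₁ - kap₂)) ^ ν) * K₀ * (m * (1 + 2 / (kap₂ - kap)) ^ ν)) * KG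
        + KΓ * K₀ * θΓ) ≤ θ)
    -- THE REDUCED KERNEL INPUTS ON THE BIGGER POLYDISC: L17a at rate κ₁, and the TWO difference bounds hdΓ, hdE at rate κ₁
    (h17 : Localisation17a cp A G Γ₀ C locΛ locN kap₁ KG KΓ KCs K₀)
    (hdΓ : ∀ σ : TPt d N' → ℂ, (∀ j, ‖σ j‖ ≤ Real.exp cp.κ₁) →
      ∀ b j, ‖(G σ - Γ₀.map (algebraMap ℝ ℂ)) b j‖ ≤ θΓ * Real.exp (-(kap₁ * tdist1 Nf (locΛ b) (locN j))))
    (hdE : ∀ σ : TPt d N' → ℂ, (∀ j, ‖σ j‖ ≤ Real.exp cp.κ₁) →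
      ∀ b b', ‖(A σ - C⁻¹.map (algebraMap ℝ ℂ)) b b'‖ ≤ θE * Real.exp (-(kap₁ * tdist1 Nf (locΛ b) (locΛ b'))))
    (hsmallKθ : K₀ * (m * (1 + 2 / kap) ^ ν) * (θ * (m * (1 + 2 / kap'') ^ ν)) < 1)
    {cE g : ℝ} (hc0 : 0 ≤ cE) (hc : ∀ k, hC.1.eigenvalues k ≤ cE)
    (hαc : (2 * (θ * (m * (1 + 2 / kap'') ^ ν)) + (γ₂ + a₂₀)) * cE ≤ 1 / 2) (hg : 0 ≤ g)
    (hΓq : ∀ X : Λ ⊕ C₀ → ℝ, (Γ₀ *ᵥ X) ⬝ᵥ (C *ᵥ (Γ₀ *ᵥ X)) ≤ g * (X ⬝ᵥ X))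
    (hsmall : (2 * (θ * (m * (1 + 2 / kap'') ^ ν)) + (γ₂ + a₂₀)) * (1 + 2 * cE * g) ≤ 1 / 2)
    {a a₅ : ℝ} (hPa : a ≤ γ₂ * rP ^ 2)
    (hvol : 2 * (K₀ * (m * (1 + 2 / kap) ^ ν) * (θ * (m * (1 + 2 / kap'') ^ ν))
              * (1 + (1 - K₀ * (m * (1 + 2 / kap) ^ ν) * (θ * (m * (1 + 2 / kap'') ^ ν)))⁻¹) / 2)
          * (Fintype.card Λ : ℝ)
        + w + (2 * (θ * (m * (1 + 2 / kap'') ^ ν)) + (γ₂ + a₂₀)) * cE * (Fintype.card Λ : ℝ)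
        + (2 * (θ * (m * (1 + 2 / kap'') ^ ν)) + (γ₂ + a₂₀)) * (1 + 2 * cE * g) * (Fintype.card (Λ ⊕ C₀) : ℝ)
        ≤ a₅ * ((Z.1).card : ℝ)) :
    ‖term214 r lZ lD (core214 A Γ (F214 t.2.card χY₀ χcP Dfam V)) 0 0‖ ≤
      weight L M c Z a t * Real.exp (a₅ * ((Z.1).card : ℝ)) := by
  have hkap0 : 0 ≤ kap := (hkap''.trans (h1.trans h2)).le
  have h12 : 0 < kap₁ - kap₂ := sub_pos.2 h4
  have h2k : 0 < kap₂ - kap := sub_pos.2 h3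
  have hθC : 0 ≤ KCs * θE * (m * (1 + 2 / (kap₁ - kap₂)) ^ ν) * K₀ * (m * (1 + 2 / (kap₂ - kap)) ^ ν) := by
    have ha : 0 ≤ (m : ℝ) * (1 + 2 / (kap₁ - kap₂)) ^ ν :=
      mul_nonneg (Nat.cast_nonneg m) (pow_nonneg (by positivity) ν)
    have hb : 0 ≤ (m : ℝ) * (1 + 2 / (kap₂ - kap)) ^ ν :=
      mul_nonneg (Nat.cast_nonneg m) (pow_nonneg (by positivity) ν)
    exact mul_nonneg (mul_nonneg (mul_nonneg (mul_nonneg hKCs hθE) ha) hK₀) hb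
  -- the σ-letters on the open `e^{κ₁⁺}`-ball from the closed one
  have hin : ∀ σ : TPt d N' → ℂ, (∀ j, σ j ∈ ball (0 : ℂ) (Real.exp cp.κ₁)) → ∀ j, ‖σ j‖ ≤ Real.exp cp.κ₁ :=
    fun σ hσ j => (mem_ball_zero_iff.1 (hσ j)).le
  have hUexp : closedBall (0 : ℂ) (Real.exp c.κ₁) ⊆ ball (0 : ℂ) (Real.exp cp.κ₁) :=
    closedBall_subset_ball (Real.exp_lt_exp.2 hκp)
  have h17' := localisation17a_mono_rate (h3.trans h4).le hKG hKΓ hKCs hK₀ h17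
  have h16 := differences216_of_two cp hC hAs hA locΛ locN hfibΛ hkap0 h3 h4 hKCs hK₀ hθΓ hθE h17 hdΓ hdE
  exact h226_torus_of_primitives_holo_polyτ c hκ₁ hα₆ Z t hpos hhalf isOpen_ball hUτ hUexp hUtau hr hr' hsubτ lZ hlZ lD
    hlD
    A Γ χY₀ χcP hχ0 hχc0 Dfam V hC Γ₀ hAhol hχm hχcm hVm (fun σ hσ => hAs σ (hin σ hσ))
    (fun σ hσ => hA σ (hin σ hσ)) G hGhol (fun σ hσ => hlin σ (hin σ hσ)) qP h222 hγ₂ hqP ha0 h220U locΛ locN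
    hfibΛ hfibN hkap'' h1 h2 hθE hθΓ hθC hKG hKΓ hKCs hK₀ hθEle hθΓle hθR1le (fun σ hσ => h17'.hG σ (hin σ hσ))
    h17'.hΓ₀ (fun σ hσ => h17'.hCs σ (hin σ hσ)) h17'.hC216 (fun σ hσ => h16.hdΓ σ (hin σ hσ))
    (fun σ hσ => h16.hdC σ (hin σ hσ)) (fun σ hσ => h16.hdE σ (hin σ hσ)) hsmallKθ hc0 hc hαc hg hΓq hsmall hPa
    hvol

end Two

end

end Literature.MathematicalPhysics.QuantumFieldTheory.Balaban1983to89.B13PrimitiveKernels216Holo
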